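import Literature.NumberTheory.ConnesConsani2021.FrequencyKernelApproxPieces
import Literature.NumberTheory.ConnesConsani2021.KernelApproxNumberBound
import Literature.NumberTheory.ConnesConsani2021.QuadrantKernelL2
import HarnessLib

/-!
# Separable `L²(ℝ²)`-approximation of the frequency kernel of `[H, f]` at a super-polynomial rate
# (Connes–Consani 2021, App. D Lemma 47 via the "direct kernel estimate" of Rem. 48)

RH-FREE analysis (cell `rh-crit`, sub-cell cc; the LAST step of the discharge of the tree fact
`Literature.NumberTheory.ConnesConsani2021.CC2021_lemma_D47`, "for `f ∈ 𝒮` the quantized differential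
`[H, f]` is an infinitesimal of infinite order", App. D Lemma D.1 = arXiv Lemma 47, p. 33).  After the
reductions of `QuantizedDiffInfiniteOrderIff` (`[H, f]` is of infinite order iff its Fourier-side
Hilbert–Schmidt conjugate is; `isInfiniteOrder_quantizedDiff_of_frequencyKernelApprox`) what remains is the
"direct kernel estimate" of Rem. 48 (p. 33 L39–41): the frequency kernel
`K(ξ, η) = −2 f̂(ξ − η) (1_{ξ > 0 ≥ η} − 1_{ξ ≤ 0 < η})` is, for every `k`, within `C_k (n+1)^{−k}` in
`L²(ℝ²)` of a separable kernel `Σ_{i<n} a_i(ξ) conj(c_i(η))` of rank `≤ n`.  This file PROVES exactly that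
statement, `frequencyKernel_separableApprox`, in the token-for-token shape of the hypothesis `h` of
`isInfiniteOrder_quantizedDiff_of_frequencyKernelApprox`.

Construction (Rem. 48 made quantitative; `g = f̂` is a Schwartz function, `SchwartzMap.fourier_coe`).
On the quadrant `{ξ > 0 ≥ η}` the kernel is `−2 g(ξ − η)`; cut `ξ ∈ (0, q²h]` into `q²` boxes of width
`h = 1/(q+1)` and Taylor-expand `g(· − η)` to degree `d = 2k` at the left end point of each box
(`SchwartzMap.norm_sub_taylor_translate_le`, bricks of `FrequencyKernelApproxPieces`): the Taylor terms are
the separable pieces `[−2 (l!)⁻¹ (ξ − jh)^l 1_{box j}(ξ)] · [g^{(l)}(jh − η) 1_{η ≤ 0}]`, `j < q²`, `l ≤ d`,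
and the error is `≤ 2 C h^{d+1} (1 + |η|)⁻¹` on the strip, `= |2 g(ξ − η)| ≤ 2M (1 + ξ + |η|)^{−8k}` beyond
it (`ξ > q²h ≥ (q+1)/2 − 1`), `= 0` off the quadrant; both error densities are dominated by SEPARABLE
integrable majorants, so `‖error‖²_{L²(ℝ²)} ≤ C' (q+1)^{−4k}` with only the FINITENESS of
`∫_ℝ (1+|x|)^{−r} dx` (`r ≥ 2`) used.  The quadrant `{ξ ≤ 0 < η}` is the same construction for the
reflected function `ǧ(x) = g(−x)` with the variables swapped.  Given `n`, take
`q = ⌊√(n / (2(d+1)))⌋`: the `2 q² (d+1) ≤ n` pieces, zero-padded to `Fin n`, give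
`√(∫‖K − Σ‖²) · (n+1)^k ≤ C`.

Theorems only: no definition (the pieces and the majorant are passed to the private lemmas as functions
with their defining equations), no named fact (net debt 0).  WHAT THIS IS NOT: any claim about RH — App. D is off the
leaf path of the cc corpus (cc-lead R42); nothing here bears on the truth of RH.

## References

* A. Connes, C. Consani, *Weil positivity and trace formula, the archimedean place*, Selecta Math. (N.S.)
  27 (2021) 77 = arXiv:2006.13771, App. D Lemma D.1 (= arXiv Lemma 47) and Remark D.2 (= Rem. 48),
  p. 33 (held chunk p0033:L22–41). [`ConnesConsani2021`]
* A. Connes, *Noncommutative Geometry* (1994), Chap. IV §2.α (approximation numbers `μ_n`).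
  [`Connes1994`]
-/

noncomputable section

open MeasureTheory Complex Set Filter
open scoped Real FourierTransform Nat ComplexConjugate

namespace Literature.NumberTheory.ConnesConsani2021

open Literature.Analysis.Calculus

namespace FrequencyKernelApprox

/-! ## Part A. One-dimensional weights and the box indicator -/

/-- RH-FREE. `x ↦ (1 + |x|)^{−r}` is integrable on `ℝ` for `r ≥ 2` (Mathlib's Japanese bracket
`integrable_one_add_norm`); only the finiteness of these integrals enters the kernel estimate.
[cite: ConnesConsani2021, App. D Rem. 48 p. 33 (arXiv chunk p0033:L39–41, "direct kernel estimate")] -/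
theorem integrable_inv_one_add_abs_pow {r : ℕ} (hr : 2 ≤ r) :
    Integrable (fun x : ℝ => ((1 + |x|) ^ r)⁻¹) (volume : Measure ℝ) := by
  have h1 : (Module.finrank ℝ ℝ : ℝ) < (r : ℝ) := by
    rw [Module.finrank_self]; exact_mod_cast (by omega : 1 < r)
  have h := integrable_one_add_norm (E := ℝ) (μ := (volume : Measure ℝ)) h1
  refine h.congr (Eventually.of_forall fun x => ?_)
  simp only [Real.norm_eq_abs]
  rw [Real.rpow_neg (by positivity), Real.rpow_natCast]

/-- RH-FREE. The weights are nonnegative. [folklore] -/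
private theorem inv_one_add_abs_pow_nonneg (r : ℕ) (x : ℝ) : 0 ≤ ((1 + |x|) ^ r)⁻¹ := by positivity

/-- RH-FREE. The weights are at most `1`. [folklore] -/
private theorem inv_one_add_abs_pow_le_one (r : ℕ) (x : ℝ) : ((1 + |x|) ^ r)⁻¹ ≤ 1 := by
  have h1 : (1 : ℝ) ≤ (1 + |x|) ^ r := one_le_pow₀ (by linarith [abs_nonneg x])
  exact inv_le_one_of_one_le₀ h1

/-- RH-FREE. `∫ 1_{(0, L]} = L` for `L ≥ 0`. [folklore] -/
private theorem integral_indicator_Ioc_zero (L : ℝ) (hL : 0 ≤ L) :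
    ∫ x : ℝ, (Ioc (0 : ℝ) L).indicator (fun _ => (1 : ℝ)) x = L := by
  rw [integral_indicator measurableSet_Ioc, setIntegral_const, smul_eq_mul, mul_one, measureReal_def,
    Real.volume_Ioc, sub_zero, ENNReal.toReal_ofReal hL]

/-- RH-FREE. The box indicator `1_{(0, L]}` is integrable. [folklore] -/
private theorem integrable_indicator_Ioc_zero (L : ℝ) :
    Integrable (fun x : ℝ => (Ioc (0 : ℝ) L).indicator (fun _ => (1 : ℝ)) x) (volume : Measure ℝ) := by
  have h : IntegrableOn (fun _ : ℝ => (1 : ℝ)) (Ioc (0 : ℝ) L) (volume : Measure ℝ) :=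
    (continuous_const.integrableOn_Icc (a := (0 : ℝ)) (b := L)).mono_set Ioc_subset_Icc_self
  exact h.integrable_indicator measurableSet_Ioc

/-! ## Part B. Boxes: `ξ ∈ (jh, (j+1)h]` iff `j + 1 = ⌈ξ/h⌉`, and the collapse of the box sum -/

/-- RH-FREE. For `h > 0`, `ξ > 0`: `ξ ∈ (jh, jh + h]` iff `⌈ξ / h⌉ = j + 1`. [folklore] -/
private theorem mem_box_iff {h ξ : ℝ} (hh : 0 < h) (j : ℕ) :
    ξ ∈ Ioc ((j : ℝ) * h) ((j : ℝ) * h + h) ↔ ⌈ξ / h⌉₊ = j + 1 := by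
  rw [Set.mem_Ioc, Nat.ceil_eq_iff (Nat.succ_ne_zero j), Nat.succ_sub_one, lt_div_iff₀ hh,
    div_le_iff₀ hh]
  push_cast
  constructor
  · rintro ⟨h1, h2⟩; constructor <;> linarith
  · rintro ⟨h1, h2⟩; constructor <;> linarith

/-- RH-FREE. **Collapse of the box sum**: for `h > 0`, `ξ > 0` and any `F`,
`Σ_{j<m} 1_{(jh, jh+h]}(ξ) F(j) = F(⌈ξ/h⌉ − 1)` if `⌈ξ/h⌉ ≤ m` (the point lies in exactly one of the
`m` boxes), and `= 0` otherwise (the point lies beyond the strip `(0, mh]`). [folklore] -/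
private theorem sum_box_indicator_mul {m : ℕ} {h ξ : ℝ} (hh : 0 < h) (hξ : 0 < ξ) (F : ℕ → ℂ) :
    ∑ j ∈ Finset.range m, (Ioc ((j : ℝ) * h) ((j : ℝ) * h + h)).indicator (fun _ => (1 : ℂ)) ξ * F j =
      if ⌈ξ / h⌉₊ ≤ m then F (⌈ξ / h⌉₊ - 1) else 0 := by
  have hJ : 1 ≤ ⌈ξ / h⌉₊ := Nat.one_le_iff_ne_zero.2 (Nat.pos_iff_ne_zero.1 (Nat.ceil_pos.2 (div_pos hξ hh)))
  have key : ∀ j : ℕ, (Ioc ((j : ℝ) * h) ((j : ℝ) * h + h)).indicator (fun _ => (1 : ℂ)) ξ * F j =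
      if j = ⌈ξ / h⌉₊ - 1 then F j else 0 := by
    intro j
    by_cases hj : ξ ∈ Ioc ((j : ℝ) * h) ((j : ℝ) * h + h)
    · have := (mem_box_iff hh j).1 hj
      rw [indicator_of_mem hj, one_mul, if_pos (by omega)]
    · rw [indicator_of_notMem hj, zero_mul, if_neg]
      intro hje
      exact hj ((mem_box_iff hh j).2 (by omega))
  simp_rw [key]
  rw [Finset.sum_ite_eq' (Finset.range m)]
  simp only [Finset.mem_range]
  by_cases hc : ⌈ξ / h⌉₊ ≤ m
  · rw [if_pos (by omega), if_pos hc]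
  · rw [if_neg (by omega), if_neg hc]

/-- RH-FREE. If `⌈ξ/h⌉ ≤ m` then `ξ ≤ m h`; if `m < ⌈ξ/h⌉` then `m h < ξ` (`h > 0`). [folklore] -/
private theorem le_strip_of_ceil_le {m : ℕ} {h ξ : ℝ} (hh : 0 < h) (hc : ⌈ξ / h⌉₊ ≤ m) :
    ξ ≤ (m : ℝ) * h := by
  have h1 : ξ / h ≤ (⌈ξ / h⌉₊ : ℝ) := Nat.le_ceil _
  have h2 : (⌈ξ / h⌉₊ : ℝ) ≤ m := by exact_mod_cast hc
  rw [div_le_iff₀ hh] at h1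
  nlinarith

/-- RH-FREE. If `m < ⌈ξ/h⌉` then `m h < ξ` (`h > 0`). [folklore] -/
private theorem strip_lt_of_lt_ceil {m : ℕ} {h ξ : ℝ} (hh : 0 < h) (hc : m < ⌈ξ / h⌉₊) :
    (m : ℝ) * h < ξ := by
  have h1 : (m : ℝ) < ξ / h := Nat.lt_ceil.1 hc
  rwa [lt_div_iff₀ hh] at h1


/-! ## Part C. The separable pieces and the pointwise error bound on the quadrant `{ξ > 0 ≥ η}`

No auxiliary definitions: the pieces and the majorant enter the lemmas below as functions `A`, `Cc`,
`F` together with their defining equations `hA`, `hC`, `hF`: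
* `A j l ξ = −2 (l!)⁻¹ (ξ − jh)^l 1_{(jh, jh+h]}(ξ)` (the `ξ`-side piece);
* `Cc j l η = conj(g^{(l)}(jh − η)) 1_{η ≤ 0}` (the `η`-side piece, conjugated so that `A · conj(Cc)` is
  the Taylor term);
* `F(ξ, η) = 4 C_T² h^{2d+2} 1_{(0,L]}(ξ) (1+|η|)^{−2} + 4 M² (1+L)^{−P} (1+|ξ|)^{−P} (1+|η|)^{−2P}` (the
  separable majorant of the squared error: strip term plus tail term). -/

/-- RH-FREE plumbing. The `ξ`-side pieces are in `L²(ℝ)` (`memLp_two_boxMonomial`). [folklore] -/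
private theorem memLp_pieceA {h : ℝ} {A : ℕ → ℕ → ℝ → ℂ}
    (hA : ∀ (j l : ℕ) (ξ : ℝ), A j l ξ = (-2) * (((l ! : ℝ) : ℂ))⁻¹ * ((ξ - (j : ℝ) * h) ^ l : ℝ) *
      (Ioc ((j : ℝ) * h) ((j : ℝ) * h + h)).indicator (fun _ => (1 : ℂ)) ξ) (j l : ℕ) :
    MemLp (A j l) 2 (volume : Measure ℝ) := by
  rw [show A j l = fun ξ => (-2) * (((l ! : ℝ) : ℂ))⁻¹ * ((ξ - (j : ℝ) * h) ^ l : ℝ) *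
      (Ioc ((j : ℝ) * h) ((j : ℝ) * h + h)).indicator (fun _ => (1 : ℂ)) ξ from funext (hA j l)]
  exact memLp_two_boxMonomial ((j : ℝ) * h) h l ((-2) * (((l ! : ℝ) : ℂ))⁻¹)

/-- RH-FREE plumbing. The `η`-side pieces are in `L²(ℝ)` (`memLp_two_schwartzDeriv_reflect`). [folklore] -/
private theorem memLp_pieceC (g : SchwartzMap ℝ ℂ) {h : ℝ} {Cc : ℕ → ℕ → ℝ → ℂ}
    (hC : ∀ (j l : ℕ) (η : ℝ), Cc j l η =
      conj (iteratedDeriv l g ((j : ℝ) * h - η)) * (Iic (0 : ℝ)).indicator (fun _ => (1 : ℂ)) η) (j l : ℕ) :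
    MemLp (Cc j l) 2 (volume : Measure ℝ) := by
  rw [show Cc j l = fun η => conj (iteratedDeriv l g ((j : ℝ) * h - η)) * (Iic (0 : ℝ)).indicator (fun _ => (1 : ℂ)) η from funext (hC j l)]
  exact memLp_two_schwartzDeriv_reflect g ((j : ℝ) * h) l

/-- RH-FREE plumbing. `conj 1_s = 1_s`. [folklore] -/
private theorem conj_indicator_one (s : Set ℝ) (x : ℝ) :
    conj (s.indicator (fun _ => (1 : ℂ)) x) = s.indicator (fun _ => (1 : ℂ)) x := by
  by_cases hx : x ∈ s
  · rw [indicator_of_mem hx, map_one]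
  · rw [indicator_of_notMem hx, map_zero]

/-- RH-FREE plumbing. The product of the pieces is the box indicator times the half-line indicator times
the Taylor term. [folklore] -/
private theorem pieceA_mul_conj_pieceC {g : SchwartzMap ℝ ℂ} {h : ℝ} {A Cc : ℕ → ℕ → ℝ → ℂ}
    (hA : ∀ (j l : ℕ) (ξ : ℝ), A j l ξ = (-2) * (((l ! : ℝ) : ℂ))⁻¹ * ((ξ - (j : ℝ) * h) ^ l : ℝ) *
      (Ioc ((j : ℝ) * h) ((j : ℝ) * h + h)).indicator (fun _ => (1 : ℂ)) ξ)
    (hC : ∀ (j l : ℕ) (η : ℝ), Cc j l η =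
      conj (iteratedDeriv l g ((j : ℝ) * h - η)) * (Iic (0 : ℝ)).indicator (fun _ => (1 : ℂ)) η) (j l : ℕ) (ξ η : ℝ) :
    A j l ξ * conj (Cc j l η) =
      (Ioc ((j : ℝ) * h) ((j : ℝ) * h + h)).indicator (fun _ => (1 : ℂ)) ξ *
        ((Iic (0 : ℝ)).indicator (fun _ => (1 : ℂ)) η *
          ((-2) * ((((l ! : ℝ)⁻¹ * (ξ - j * h) ^ l : ℝ) : ℂ) * iteratedDeriv l g (j * h - η)))) := by
  rw [hA, hC]
  simp only [map_mul, Complex.conj_conj, conj_indicator_one]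
  push_cast
  ring

/-- RH-FREE plumbing. The `ξ`-side pieces vanish at `ξ ≤ 0`. [folklore] -/
private theorem pieceA_eq_zero_of_nonpos {h : ℝ} (hh : 0 < h) {A : ℕ → ℕ → ℝ → ℂ}
    (hA : ∀ (j l : ℕ) (ξ : ℝ), A j l ξ = (-2) * (((l ! : ℝ) : ℂ))⁻¹ * ((ξ - (j : ℝ) * h) ^ l : ℝ) *
      (Ioc ((j : ℝ) * h) ((j : ℝ) * h + h)).indicator (fun _ => (1 : ℂ)) ξ) (j l : ℕ) {ξ : ℝ} (hξ : ξ ≤ 0) :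
    A j l ξ = 0 := by
  have hn : ξ ∉ Ioc ((j : ℝ) * h) ((j : ℝ) * h + h) := by
    intro hm
    have h1 : (0 : ℝ) ≤ (j : ℝ) * h := by positivity
    linarith [hm.1]
  simp [hA, indicator_of_notMem hn]

/-- RH-FREE plumbing. The `η`-side pieces vanish at `η > 0`. [folklore] -/
private theorem pieceC_eq_zero_of_pos {g : SchwartzMap ℝ ℂ} {h : ℝ} {Cc : ℕ → ℕ → ℝ → ℂ}
    (hC : ∀ (j l : ℕ) (η : ℝ), Cc j l η =
      conj (iteratedDeriv l g ((j : ℝ) * h - η)) * (Iic (0 : ℝ)).indicator (fun _ => (1 : ℂ)) η) (j l : ℕ) {η : ℝ} (hη : 0 < η) :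
    Cc j l η = 0 := by
  have hn : η ∉ Iic (0 : ℝ) := fun hm => by simp only [mem_Iic] at hm; linarith
  simp [hC, indicator_of_notMem hn]

/-- RH-FREE plumbing. The separable sum over `Fin m × Fin (d+1)` collapses to the Taylor sum of the box
containing `ξ > 0` (or to `0` beyond the strip). [folklore] -/
private theorem sum_pieces_eq {g : SchwartzMap ℝ ℂ} {h : ℝ} (hh : 0 < h) {A Cc : ℕ → ℕ → ℝ → ℂ}
    (hA : ∀ (j l : ℕ) (ξ : ℝ), A j l ξ = (-2) * (((l ! : ℝ) : ℂ))⁻¹ * ((ξ - (j : ℝ) * h) ^ l : ℝ) *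
      (Ioc ((j : ℝ) * h) ((j : ℝ) * h + h)).indicator (fun _ => (1 : ℂ)) ξ)
    (hC : ∀ (j l : ℕ) (η : ℝ), Cc j l η =
      conj (iteratedDeriv l g ((j : ℝ) * h - η)) * (Iic (0 : ℝ)).indicator (fun _ => (1 : ℂ)) η) (m d : ℕ) {ξ : ℝ}
    (hξ : 0 < ξ) (η : ℝ) :
    ∑ i : Fin m × Fin (d + 1), A i.1 i.2 ξ * conj (Cc i.1 i.2 η) =
      if ⌈ξ / h⌉₊ ≤ m then (Iic (0 : ℝ)).indicator (fun _ => (1 : ℂ)) η *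
        ∑ l ∈ Finset.range (d + 1), (-2) * ((((l ! : ℝ)⁻¹ * (ξ - (⌈ξ / h⌉₊ - 1 : ℕ) * h) ^ l : ℝ) : ℂ) *
          iteratedDeriv l g ((⌈ξ / h⌉₊ - 1 : ℕ) * h - η)) else 0 := by
  rw [Fintype.sum_prod_type]
  simp_rw [pieceA_mul_conj_pieceC hA hC]
  rw [Fin.sum_univ_eq_sum_range (fun j => ∑ l : Fin (d + 1),
      (Ioc ((j : ℝ) * h) ((j : ℝ) * h + h)).indicator (fun _ => (1 : ℂ)) ξ *
        ((Iic (0 : ℝ)).indicator (fun _ => (1 : ℂ)) η *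
          ((-2) * (((((l : ℕ) ! : ℝ)⁻¹ * (ξ - j * h) ^ (l : ℕ) : ℝ) : ℂ) *
            iteratedDeriv (l : ℕ) g (j * h - η))))) m]
  have hinner : ∀ j : ℕ, ∑ l : Fin (d + 1),
      (Ioc ((j : ℝ) * h) ((j : ℝ) * h + h)).indicator (fun _ => (1 : ℂ)) ξ *
        ((Iic (0 : ℝ)).indicator (fun _ => (1 : ℂ)) η *
          ((-2) * (((((l : ℕ) ! : ℝ)⁻¹ * (ξ - j * h) ^ (l : ℕ) : ℝ) : ℂ) *
            iteratedDeriv (l : ℕ) g (j * h - η)))) =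
      (Ioc ((j : ℝ) * h) ((j : ℝ) * h + h)).indicator (fun _ => (1 : ℂ)) ξ *
        ((Iic (0 : ℝ)).indicator (fun _ => (1 : ℂ)) η *
          ∑ l ∈ Finset.range (d + 1), (-2) * ((((l ! : ℝ)⁻¹ * (ξ - j * h) ^ l : ℝ) : ℂ) *
            iteratedDeriv l g (j * h - η))) := by
    intro j
    rw [Finset.mul_sum, Finset.mul_sum,
      Fin.sum_univ_eq_sum_range (fun l => (Ioc ((j : ℝ) * h) ((j : ℝ) * h + h)).indicator
        (fun _ => (1 : ℂ)) ξ * ((Iic (0 : ℝ)).indicator (fun _ => (1 : ℂ)) η *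
          ((-2) * ((((l ! : ℝ)⁻¹ * (ξ - j * h) ^ l : ℝ) : ℂ) * iteratedDeriv l g (j * h - η))))) (d + 1)]
  simp_rw [hinner]
  rw [sum_box_indicator_mul hh hξ]

/-- RH-FREE plumbing. **The pointwise error bound on the quadrant `{ξ > 0 ≥ η}`** (and zero error
elsewhere): the squared error of the box-Taylor separable approximant is dominated by the separable
majorant `F`. [folklore] -/
private theorem norm_sq_error_le (g : SchwartzMap ℝ ℂ) {d P : ℕ} {CT M : ℝ} (hCT0 : 0 ≤ CT)
    (hCT : ∀ (j : ℕ) (h ξ η : ℝ), 0 < h → ξ ∈ Ioc ((j : ℝ) * h) ((j : ℝ) * h + h) → η ≤ 0 →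
      ‖(-2) * (g : ℝ → ℂ) (ξ - η) - ∑ l ∈ Finset.range (d + 1),
          (-2) * ((((l ! : ℝ)⁻¹ * (ξ - j * h) ^ l : ℝ) : ℂ) * iteratedDeriv l g (j * h - η))‖
        ≤ 2 * CT * h ^ (d + 1) * ((1 + |η|) ^ 1)⁻¹)
    (hM : ∀ w : ℝ, ‖(g : ℝ → ℂ) w‖ ≤ M * ((1 + |w|) ^ (4 * P))⁻¹)
    {h : ℝ} (hh : 0 < h) (m : ℕ) {A Cc : ℕ → ℕ → ℝ → ℂ}
    (hA : ∀ (j l : ℕ) (ξ : ℝ), A j l ξ = (-2) * (((l ! : ℝ) : ℂ))⁻¹ * ((ξ - (j : ℝ) * h) ^ l : ℝ) *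
      (Ioc ((j : ℝ) * h) ((j : ℝ) * h + h)).indicator (fun _ => (1 : ℂ)) ξ)
    (hC : ∀ (j l : ℕ) (η : ℝ), Cc j l η =
      conj (iteratedDeriv l g ((j : ℝ) * h - η)) * (Iic (0 : ℝ)).indicator (fun _ => (1 : ℂ)) η)
    {F : ℝ × ℝ → ℝ} (hF : ∀ z : ℝ × ℝ, F z =
      4 * CT ^ 2 * h ^ (2 * d + 2) * (Ioc (0 : ℝ) ((m : ℝ) * h)).indicator (fun _ => (1 : ℝ)) z.1 * ((1 + |z.2|) ^ 2)⁻¹ +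
      4 * M ^ 2 * ((1 + ((m : ℝ) * h)) ^ P)⁻¹ * ((1 + |z.1|) ^ P)⁻¹ * ((1 + |z.2|) ^ (2 * P))⁻¹) (z : ℝ × ℝ) :
    ‖(-2) * g (z.1 - z.2) * (if 0 < z.1 ∧ z.2 ≤ 0 then (1 : ℂ) else 0) -
        ∑ i : Fin m × Fin (d + 1), A i.1 i.2 z.1 * conj (Cc i.1 i.2 z.2)‖ ^ 2 ≤ F z := by
  obtain ⟨ξ, η⟩ := z
  set L : ℝ := (m : ℝ) * h with hL
  have hL0 : 0 ≤ L := by positivity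
  -- the two terms of the majorant are nonnegative
  have hT1 : 0 ≤ 4 * CT ^ 2 * h ^ (2 * d + 2) * (Ioc (0 : ℝ) L).indicator (fun _ => (1 : ℝ)) ξ *
      ((1 + |η|) ^ 2)⁻¹ := by
    have : 0 ≤ (Ioc (0 : ℝ) L).indicator (fun _ => (1 : ℝ)) ξ :=
      Set.indicator_nonneg (fun _ _ => zero_le_one) _
    positivity
  have hT2 : 0 ≤ 4 * M ^ 2 * ((1 + L) ^ P)⁻¹ * ((1 + |ξ|) ^ P)⁻¹ * ((1 + |η|) ^ (2 * P))⁻¹ := by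
    positivity
  have hF0 : 0 ≤ F (ξ, η) := by
    rw [hF]; exact add_nonneg hT1 hT2
  simp only
  by_cases hη : η ≤ 0
  · have hIη : (Iic (0 : ℝ)).indicator (fun _ => (1 : ℂ)) η = 1 := indicator_of_mem (mem_Iic.2 hη) _
    by_cases hξ : 0 < ξ
    · have hQ : (if 0 < ξ ∧ η ≤ 0 then (1 : ℂ) else 0) = 1 := if_pos ⟨hξ, hη⟩
      rw [hQ, mul_one, sum_pieces_eq hh hA hC m d hξ η, hIη]
      by_cases hc : ⌈ξ / h⌉₊ ≤ m
      · -- on the strip: the Taylor remainder on the box `j₀ = ⌈ξ/h⌉ − 1`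
        rw [if_pos hc, one_mul]
        have hJ : 1 ≤ ⌈ξ / h⌉₊ :=
          Nat.one_le_iff_ne_zero.2 (Nat.pos_iff_ne_zero.1 (Nat.ceil_pos.2 (div_pos hξ hh)))
        have hmem : ξ ∈ Ioc (((⌈ξ / h⌉₊ - 1 : ℕ) : ℝ) * h) (((⌈ξ / h⌉₊ - 1 : ℕ) : ℝ) * h + h) :=
          (mem_box_iff hh _).2 (by omega)
        have hrem := hCT (⌈ξ / h⌉₊ - 1) h ξ η hh hmem hη
        have hξL : ξ ≤ L := le_strip_of_ceil_le hh hc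
        have hIξ : (Ioc (0 : ℝ) L).indicator (fun _ => (1 : ℝ)) ξ = 1 :=
          indicator_of_mem (show ξ ∈ Ioc (0 : ℝ) L from ⟨hξ, hξL⟩) _
        have hB0 : 0 ≤ 2 * CT * h ^ (d + 1) * ((1 + |η|) ^ 1)⁻¹ := by positivity
        have hsq : ‖(-2) * (g : ℝ → ℂ) (ξ - η) - ∑ l ∈ Finset.range (d + 1),
            (-2) * ((((l ! : ℝ)⁻¹ * (ξ - (⌈ξ / h⌉₊ - 1 : ℕ) * h) ^ l : ℝ) : ℂ) *
              iteratedDeriv l g ((⌈ξ / h⌉₊ - 1 : ℕ) * h - η))‖ ^ 2 ≤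
            (2 * CT * h ^ (d + 1) * ((1 + |η|) ^ 1)⁻¹) ^ 2 :=
          pow_le_pow_left₀ (norm_nonneg _) hrem 2
        have heq : (2 * CT * h ^ (d + 1) * ((1 + |η|) ^ 1)⁻¹) ^ 2 =
            4 * CT ^ 2 * h ^ (2 * d + 2) * 1 * ((1 + |η|) ^ 2)⁻¹ := by
          rw [pow_one, show 2 * d + 2 = 2 * (d + 1) by ring, pow_mul]
          field_simp
          ring
        rw [hF, hIξ]
        linarith [hsq, heq, hT2]
      · -- beyond the strip: the separable sum vanishes, the kernel is `−2 g(ξ − η)` with `ξ − η ≥ L`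
        rw [if_neg hc, sub_zero]
        have hξL : L < ξ := strip_lt_of_lt_ceil hh (not_le.1 hc)
        have hw := hM (ξ - η)
        have habs : |ξ - η| = ξ + |η| := by
          rw [abs_of_nonpos hη, abs_of_pos (by linarith)]; ring
        -- `(1 + ξ + |η|)^{4P} ≥ (1+L)^P (1+ξ)^P (1+|η|)^{2P}`
        have hx1 : (1 : ℝ) ≤ 1 + ξ := by linarith
        have hy1 : (1 : ℝ) ≤ 1 + |η| := by linarith [abs_nonneg η]
        have hprod : (1 + L) ^ P * ((1 + |ξ|) ^ P * (1 + |η|) ^ (2 * P)) ≤ (1 + |ξ - η|) ^ (4 * P) := by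
          rw [habs, abs_of_pos hξ]
          have h1 : (1 + L) ^ P ≤ (1 + ξ) ^ P := pow_le_pow_left₀ (by linarith) (by linarith) P
          have h2 : (1 + ξ) * (1 + |η|) ≤ (1 + ξ + |η|) ^ 2 := by nlinarith [abs_nonneg η]
          have h3 : ((1 + ξ) * (1 + |η|)) ^ (2 * P) ≤ ((1 + ξ + |η|) ^ 2) ^ (2 * P) :=
            pow_le_pow_left₀ (by positivity) h2 _
          calc (1 + L) ^ P * ((1 + ξ) ^ P * (1 + |η|) ^ (2 * P))
              ≤ (1 + ξ) ^ P * ((1 + ξ) ^ P * (1 + |η|) ^ (2 * P)) := by gcongr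
            _ = ((1 + ξ) * (1 + |η|)) ^ (2 * P) := by rw [← mul_assoc, ← pow_add, ← two_mul, mul_pow]
            _ ≤ ((1 + ξ + |η|) ^ 2) ^ (2 * P) := h3
            _ = (1 + (ξ + |η|)) ^ (4 * P) := by
                rw [← pow_mul, show 2 * (2 * P) = 4 * P by ring, add_assoc]
        have hwpos : 0 < (1 + L) ^ P * ((1 + |ξ|) ^ P * (1 + |η|) ^ (2 * P)) := by positivity
        have hw1 : ((1 + |ξ - η|) ^ (4 * P))⁻¹ ≤ ((1 + L) ^ P * ((1 + |ξ|) ^ P * (1 + |η|) ^ (2 * P)))⁻¹ :=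
          inv_anti₀ hwpos hprod
        have hwle1 : ((1 + |ξ - η|) ^ (4 * P))⁻¹ ≤ 1 := inv_one_add_abs_pow_le_one _ _
        have hw0 : 0 ≤ ((1 + |ξ - η|) ^ (4 * P))⁻¹ := by positivity
        -- `‖−2 g(ξ−η)‖² = 4‖g‖² ≤ 4 M² w² ≤ 4 M² w ≤ tail term`
        have hn : ‖(-2) * (g : ℝ → ℂ) (ξ - η)‖ ^ 2 = 4 * ‖(g : ℝ → ℂ) (ξ - η)‖ ^ 2 := by
          rw [norm_mul, mul_pow]; norm_num
        have hg2 : ‖(g : ℝ → ℂ) (ξ - η)‖ ^ 2 ≤ (M * ((1 + |ξ - η|) ^ (4 * P))⁻¹) ^ 2 :=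
          pow_le_pow_left₀ (norm_nonneg _) hw 2
        have hchain : (M * ((1 + |ξ - η|) ^ (4 * P))⁻¹) ^ 2 ≤
            M ^ 2 * ((1 + L) ^ P * ((1 + |ξ|) ^ P * (1 + |η|) ^ (2 * P)))⁻¹ := by
          rw [mul_pow]
          have : (((1 + |ξ - η|) ^ (4 * P))⁻¹) ^ 2 ≤ ((1 + |ξ - η|) ^ (4 * P))⁻¹ := by
            rw [sq]; exact mul_le_of_le_one_left hw0 hwle1
          nlinarith [mul_le_mul_of_nonneg_left (this.trans hw1) (sq_nonneg M)]
        rw [hF]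
        rw [mul_inv, mul_inv] at hchain
        nlinarith [hn, hg2, hchain, hT1]
    · -- `ξ ≤ 0`: no kernel, no pieces
      have hξ' : ξ ≤ 0 := not_lt.1 hξ
      have hQ : (if 0 < ξ ∧ η ≤ 0 then (1 : ℂ) else 0) = 0 := if_neg (fun h' => hξ h'.1)
      have hS : ∑ i : Fin m × Fin (d + 1), A i.1 i.2 ξ * conj (Cc i.1 i.2 η) = 0 :=
        Finset.sum_eq_zero fun i _ => by rw [pieceA_eq_zero_of_nonpos hh hA _ _ hξ', zero_mul]
      rw [hQ, hS, mul_zero, sub_zero, norm_zero, zero_pow two_ne_zero]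
      exact hF0
  · -- `η > 0`: no kernel, no pieces
    have hη' : 0 < η := not_le.1 hη
    have hQ : (if 0 < ξ ∧ η ≤ 0 then (1 : ℂ) else 0) = 0 := if_neg (fun h' => hη h'.2)
    have hS : ∑ i : Fin m × Fin (d + 1), A i.1 i.2 ξ * conj (Cc i.1 i.2 η) = 0 :=
      Finset.sum_eq_zero fun i _ => by rw [pieceC_eq_zero_of_pos hC _ _ hη', map_zero, mul_zero]
    rw [hQ, hS, mul_zero, sub_zero, norm_zero, zero_pow two_ne_zero]
    exact hF0


/-! ## Part D. The majorant is integrable, with integral `O((q+1)^{−4k})` for `h = 1/(q+1)`, `L = q²h` -/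

/-- RH-FREE plumbing. The separable majorant is integrable on `ℝ²` (`Integrable.mul_prod`). [folklore] -/
private theorem integrable_majorant {CT M h L : ℝ} {d P : ℕ} (hP : 2 ≤ P) {F : ℝ × ℝ → ℝ}
    (hF : ∀ z : ℝ × ℝ, F z =
      4 * CT ^ 2 * h ^ (2 * d + 2) * (Ioc (0 : ℝ) L).indicator (fun _ => (1 : ℝ)) z.1 * ((1 + |z.2|) ^ 2)⁻¹ +
      4 * M ^ 2 * ((1 + L) ^ P)⁻¹ * ((1 + |z.1|) ^ P)⁻¹ * ((1 + |z.2|) ^ (2 * P))⁻¹) :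
    Integrable F ((volume : Measure ℝ).prod volume) := by
  have h1 : Integrable (fun z : ℝ × ℝ => (4 * CT ^ 2 * h ^ (2 * d + 2) *
      (Ioc (0 : ℝ) L).indicator (fun _ => (1 : ℝ)) z.1) * ((1 + |z.2|) ^ 2)⁻¹)
      ((volume : Measure ℝ).prod volume) :=
    ((integrable_indicator_Ioc_zero L).const_mul _).mul_prod (integrable_inv_one_add_abs_pow le_rfl)
  have h2 : Integrable (fun z : ℝ × ℝ => (4 * M ^ 2 * ((1 + L) ^ P)⁻¹ * ((1 + |z.1|) ^ P)⁻¹) *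
      ((1 + |z.2|) ^ (2 * P))⁻¹) ((volume : Measure ℝ).prod volume) :=
    ((integrable_inv_one_add_abs_pow hP).const_mul _).mul_prod
      (integrable_inv_one_add_abs_pow (by omega))
  exact (h1.add h2).congr (Eventually.of_forall fun z => by simp only [hF, Pi.add_apply])

/-- RH-FREE plumbing. The integral of the separable majorant (`integral_prod_mul`). [folklore] -/
private theorem integral_majorant {CT M h L : ℝ} (hL : 0 ≤ L) {d P : ℕ} (hP : 2 ≤ P) {F : ℝ × ℝ → ℝ}
    (hF : ∀ z : ℝ × ℝ, F z =
      4 * CT ^ 2 * h ^ (2 * d + 2) * (Ioc (0 : ℝ) L).indicator (fun _ => (1 : ℝ)) z.1 * ((1 + |z.2|) ^ 2)⁻¹ +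
      4 * M ^ 2 * ((1 + L) ^ P)⁻¹ * ((1 + |z.1|) ^ P)⁻¹ * ((1 + |z.2|) ^ (2 * P))⁻¹) :
    ∫ z, F z ∂((volume : Measure ℝ).prod volume) =
      4 * CT ^ 2 * h ^ (2 * d + 2) * L * (∫ y : ℝ, ((1 + |y|) ^ 2)⁻¹) +
      4 * M ^ 2 * ((1 + L) ^ P)⁻¹ * (∫ x : ℝ, ((1 + |x|) ^ P)⁻¹) *
        (∫ y : ℝ, ((1 + |y|) ^ (2 * P))⁻¹) := by
  have h1 : Integrable (fun z : ℝ × ℝ => (4 * CT ^ 2 * h ^ (2 * d + 2) *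
      (Ioc (0 : ℝ) L).indicator (fun _ => (1 : ℝ)) z.1) * ((1 + |z.2|) ^ 2)⁻¹)
      ((volume : Measure ℝ).prod volume) :=
    ((integrable_indicator_Ioc_zero L).const_mul _).mul_prod (integrable_inv_one_add_abs_pow le_rfl)
  have h2 : Integrable (fun z : ℝ × ℝ => (4 * M ^ 2 * ((1 + L) ^ P)⁻¹ * ((1 + |z.1|) ^ P)⁻¹) *
      ((1 + |z.2|) ^ (2 * P))⁻¹) ((volume : Measure ℝ).prod volume) :=
    ((integrable_inv_one_add_abs_pow hP).const_mul _).mul_prod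
      (integrable_inv_one_add_abs_pow (by omega))
  have e : F = fun z : ℝ × ℝ =>
      (4 * CT ^ 2 * h ^ (2 * d + 2) * (Ioc (0 : ℝ) L).indicator (fun _ => (1 : ℝ)) z.1) *
        ((1 + |z.2|) ^ 2)⁻¹ +
      (4 * M ^ 2 * ((1 + L) ^ P)⁻¹ * ((1 + |z.1|) ^ P)⁻¹) * ((1 + |z.2|) ^ (2 * P))⁻¹ := by
    funext z; rw [hF]
  rw [e, integral_add h1 h2,
    integral_prod_mul (μ := (volume : Measure ℝ)) (ν := (volume : Measure ℝ))
      (fun x : ℝ => 4 * CT ^ 2 * h ^ (2 * d + 2) * (Ioc (0 : ℝ) L).indicator (fun _ => (1 : ℝ)) x)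
      (fun y : ℝ => ((1 + |y|) ^ 2)⁻¹),
    integral_prod_mul (μ := (volume : Measure ℝ)) (ν := (volume : Measure ℝ))
      (fun x : ℝ => 4 * M ^ 2 * ((1 + L) ^ P)⁻¹ * ((1 + |x|) ^ P)⁻¹)
      (fun y : ℝ => ((1 + |y|) ^ (2 * P))⁻¹),
    integral_const_mul, integral_const_mul, integral_indicator_Ioc_zero L hL]

/-- `h^{2d+2} · L ≤ (q+1)^{−4k}` for `h = 1/(q+1)`, `L = q² h`, `d = 2k`. [folklore] -/
private theorem strip_factor_le (q k : ℕ) :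
    (((q : ℝ) + 1)⁻¹) ^ (2 * (2 * k) + 2) * ((((q ^ 2 : ℕ) : ℝ)) * ((q : ℝ) + 1)⁻¹) ≤
      (((q : ℝ) + 1) ^ (4 * k))⁻¹ := by
  have hx : (0 : ℝ) < (q : ℝ) + 1 := by positivity
  rw [Nat.cast_pow, show 2 * (2 * k) + 2 = 4 * k + 2 by ring]
  have hqx : (q : ℝ) ^ 2 ≤ ((q : ℝ) + 1) ^ 2 := by nlinarith
  calc ((q : ℝ) + 1)⁻¹ ^ (4 * k + 2) * ((q : ℝ) ^ 2 * ((q : ℝ) + 1)⁻¹)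
      ≤ ((q : ℝ) + 1)⁻¹ ^ (4 * k + 2) * (((q : ℝ) + 1) ^ 2 * ((q : ℝ) + 1)⁻¹) := by gcongr
    _ = (((q : ℝ) + 1) ^ (4 * k))⁻¹ * ((q : ℝ) + 1)⁻¹ := by
        rw [inv_pow, pow_add]
        field_simp
    _ ≤ (((q : ℝ) + 1) ^ (4 * k))⁻¹ * 1 := by
        gcongr
        exact inv_le_one_of_one_le₀ (by linarith)
    _ = (((q : ℝ) + 1) ^ (4 * k))⁻¹ := mul_one _

/-- `(1 + L)^{−P} ≤ 2^P (q+1)^{−P}` for `L = q²/(q+1)` (`1 + L ≥ (q+1)/2`). [folklore] -/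
private theorem tail_factor_le (q P : ℕ) :
    ((1 + (((q ^ 2 : ℕ) : ℝ)) * ((q : ℝ) + 1)⁻¹) ^ P)⁻¹ ≤ 2 ^ P * (((q : ℝ) + 1) ^ P)⁻¹ := by
  have hx : (0 : ℝ) < (q : ℝ) + 1 := by positivity
  rw [Nat.cast_pow]
  have hle : ((q : ℝ) + 1) / 2 ≤ 1 + (q : ℝ) ^ 2 * ((q : ℝ) + 1)⁻¹ := by
    have e : 1 + (q : ℝ) ^ 2 * ((q : ℝ) + 1)⁻¹ = ((q : ℝ) + 1 + (q : ℝ) ^ 2) / ((q : ℝ) + 1) := by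
      field_simp
    rw [e, div_le_div_iff₀ (by norm_num) hx]
    nlinarith
  have hpos : 0 < ((q : ℝ) + 1) / 2 := by positivity
  calc ((1 + (q : ℝ) ^ 2 * ((q : ℝ) + 1)⁻¹) ^ P)⁻¹ ≤ ((((q : ℝ) + 1) / 2) ^ P)⁻¹ :=
        inv_anti₀ (pow_pos hpos P) (pow_le_pow_left₀ hpos.le hle P)
    _ = 2 ^ P * (((q : ℝ) + 1) ^ P)⁻¹ := by rw [div_pow, inv_div, div_eq_mul_inv]

/-- RH-FREE. **The quadrant estimate** (App. D Rem. 48's direct kernel estimate on `{ξ > 0 ≥ η}`): for a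
Schwartz `g` and `k ≥ 1` there is `C` such that for every `q` the `q²(2k+1)` box-Taylor pieces
`a_{j,l}`, `c_{j,l}` (in `L²(ℝ)`) approximate `−2 g(ξ−η) 1_{ξ>0≥η}` with squared error dominated by an
integrable function of integral `≤ C (q+1)^{−4k}`.
[cite: ConnesConsani2021, App. D Rem. 48 p. 33 (arXiv chunk p0033:L39–41); Lemma 47 proof (L24–36)] -/
theorem quadrant_separableApprox (g : SchwartzMap ℝ ℂ) {k : ℕ} (hk : 1 ≤ k) :
    ∃ C : ℝ, 0 ≤ C ∧ ∀ q : ℕ, ∃ A Cc : Fin (q ^ 2) × Fin (2 * k + 1) → ℝ → ℂ,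
      (∀ i, MemLp (A i) 2 (volume : Measure ℝ)) ∧ (∀ i, MemLp (Cc i) 2 (volume : Measure ℝ)) ∧
      ∃ F : ℝ × ℝ → ℝ, Integrable F ((volume : Measure ℝ).prod volume) ∧
        (∀ z : ℝ × ℝ, ‖(-2) * g (z.1 - z.2) * (if 0 < z.1 ∧ z.2 ≤ 0 then (1 : ℂ) else 0) -
            ∑ i, A i z.1 * conj (Cc i z.2)‖ ^ 2 ≤ F z) ∧
        ∫ z, F z ∂((volume : Measure ℝ).prod volume) ≤ C * (((q : ℝ) + 1) ^ (4 * k))⁻¹ := by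
  obtain ⟨CT, hCT0, hCT⟩ := norm_quadrantKernel_sub_boxTaylor_le g (2 * k) 1
  obtain ⟨M, hM0, hM⟩ := SchwartzMap.norm_iteratedDeriv_le_inv_one_add_pow g (4 * (4 * k)) 0
  simp only [iteratedDeriv_zero] at hM
  have hP2 : 2 ≤ 4 * k := by omega
  have hJ2 : 0 ≤ ∫ y : ℝ, ((1 + |y|) ^ 2)⁻¹ := integral_nonneg fun _ => inv_one_add_abs_pow_nonneg _ _
  have hJP : 0 ≤ ∫ x : ℝ, ((1 + |x|) ^ (4 * k))⁻¹ :=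
    integral_nonneg fun _ => inv_one_add_abs_pow_nonneg _ _
  have hJ2P : 0 ≤ ∫ y : ℝ, ((1 + |y|) ^ (2 * (4 * k)))⁻¹ :=
    integral_nonneg fun _ => inv_one_add_abs_pow_nonneg _ _
  refine ⟨4 * CT ^ 2 * (∫ y : ℝ, ((1 + |y|) ^ 2)⁻¹) +
      4 * M ^ 2 * 2 ^ (4 * k) * (∫ x : ℝ, ((1 + |x|) ^ (4 * k))⁻¹) *
        (∫ y : ℝ, ((1 + |y|) ^ (2 * (4 * k)))⁻¹), by positivity, fun q => ?_⟩
  have hq1 : (0 : ℝ) < (q : ℝ) + 1 := by positivity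
  have hh : 0 < ((q : ℝ) + 1)⁻¹ := inv_pos.2 hq1
  have hL0 : 0 ≤ (((q ^ 2 : ℕ) : ℝ)) * ((q : ℝ) + 1)⁻¹ := by positivity
  -- the pieces and the majorant for `h = 1/(q+1)`, `m = q²` boxes, `L = q² h`, `d = 2k`, `P = 4k`
  let A : ℕ → ℕ → ℝ → ℂ := fun j l ξ => (-2) * (((l ! : ℝ) : ℂ))⁻¹ *
    ((ξ - (j : ℝ) * ((q : ℝ) + 1)⁻¹) ^ l : ℝ) *
      (Ioc ((j : ℝ) * ((q : ℝ) + 1)⁻¹) ((j : ℝ) * ((q : ℝ) + 1)⁻¹ + ((q : ℝ) + 1)⁻¹)).indicator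
        (fun _ => (1 : ℂ)) ξ
  let Cc : ℕ → ℕ → ℝ → ℂ := fun j l η =>
    conj (iteratedDeriv l g ((j : ℝ) * ((q : ℝ) + 1)⁻¹ - η)) * (Iic (0 : ℝ)).indicator (fun _ => (1 : ℂ)) η
  let F : ℝ × ℝ → ℝ := fun z =>
    4 * CT ^ 2 * (((q : ℝ) + 1)⁻¹) ^ (2 * (2 * k) + 2) *
        (Ioc (0 : ℝ) ((((q ^ 2 : ℕ) : ℝ)) * ((q : ℝ) + 1)⁻¹)).indicator (fun _ => (1 : ℝ)) z.1 *
          ((1 + |z.2|) ^ 2)⁻¹ +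
      4 * M ^ 2 * ((1 + (((q ^ 2 : ℕ) : ℝ)) * ((q : ℝ) + 1)⁻¹) ^ (4 * k))⁻¹ * ((1 + |z.1|) ^ (4 * k))⁻¹ *
        ((1 + |z.2|) ^ (2 * (4 * k)))⁻¹
  have hA : ∀ (j l : ℕ) (ξ : ℝ), A j l ξ = (-2) * (((l ! : ℝ) : ℂ))⁻¹ *
      ((ξ - (j : ℝ) * ((q : ℝ) + 1)⁻¹) ^ l : ℝ) *
        (Ioc ((j : ℝ) * ((q : ℝ) + 1)⁻¹) ((j : ℝ) * ((q : ℝ) + 1)⁻¹ + ((q : ℝ) + 1)⁻¹)).indicator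
          (fun _ => (1 : ℂ)) ξ := fun _ _ _ => rfl
  have hC : ∀ (j l : ℕ) (η : ℝ), Cc j l η = conj (iteratedDeriv l g ((j : ℝ) * ((q : ℝ) + 1)⁻¹ - η)) *
      (Iic (0 : ℝ)).indicator (fun _ => (1 : ℂ)) η := fun _ _ _ => rfl
  have hFm : ∀ z : ℝ × ℝ, F z = 4 * CT ^ 2 * (((q : ℝ) + 1)⁻¹) ^ (2 * (2 * k) + 2) *
      (Ioc (0 : ℝ) (((q ^ 2 : ℕ) : ℝ) * ((q : ℝ) + 1)⁻¹)).indicator (fun _ => (1 : ℝ)) z.1 *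
        ((1 + |z.2|) ^ 2)⁻¹ +
      4 * M ^ 2 * ((1 + (((q ^ 2 : ℕ) : ℝ)) * ((q : ℝ) + 1)⁻¹) ^ (4 * k))⁻¹ * ((1 + |z.1|) ^ (4 * k))⁻¹ *
        ((1 + |z.2|) ^ (2 * (4 * k)))⁻¹ := fun _ => rfl
  have hFL : ∀ z : ℝ × ℝ, F z = 4 * CT ^ 2 * (((q : ℝ) + 1)⁻¹) ^ (2 * (2 * k) + 2) *
      (Ioc (0 : ℝ) (((q ^ 2 : ℕ) : ℝ) * ((q : ℝ) + 1)⁻¹)).indicator (fun _ => (1 : ℝ)) z.1 *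
        ((1 + |z.2|) ^ 2)⁻¹ +
      4 * M ^ 2 * ((1 + (((q ^ 2 : ℕ) : ℝ)) * ((q : ℝ) + 1)⁻¹) ^ (4 * k))⁻¹ * ((1 + |z.1|) ^ (4 * k))⁻¹ *
        ((1 + |z.2|) ^ (2 * (4 * k)))⁻¹ := fun _ => rfl
  refine ⟨fun i => A i.1 i.2, fun i => Cc i.1 i.2, fun i => memLp_pieceA hA _ _,
    fun i => memLp_pieceC g hC _ _, F, integrable_majorant hP2 hFL,
    fun z => norm_sq_error_le g hCT0 hCT hM hh (q ^ 2) hA hC (by simpa only [Nat.cast_pow] using hFm) z,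
    ?_⟩
  rw [integral_majorant hL0 hP2 hFL]
  have hi := strip_factor_le q k
  have hii := tail_factor_le q (4 * k)
  have t1 := mul_le_mul_of_nonneg_left hi
    (by positivity : (0 : ℝ) ≤ 4 * CT ^ 2 * ∫ y : ℝ, ((1 + |y|) ^ 2)⁻¹)
  have t2 := mul_le_mul_of_nonneg_left hii
    (by positivity : (0 : ℝ) ≤ 4 * M ^ 2 * (∫ x : ℝ, ((1 + |x|) ^ (4 * k))⁻¹) *
      (∫ y : ℝ, ((1 + |y|) ^ (2 * (4 * k)))⁻¹))
  calc 4 * CT ^ 2 * ((q : ℝ) + 1)⁻¹ ^ (2 * (2 * k) + 2) * ((((q ^ 2 : ℕ) : ℝ)) * ((q : ℝ) + 1)⁻¹) *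
          (∫ y : ℝ, ((1 + |y|) ^ 2)⁻¹) +
        4 * M ^ 2 * ((1 + (((q ^ 2 : ℕ) : ℝ)) * ((q : ℝ) + 1)⁻¹) ^ (4 * k))⁻¹ *
          (∫ x : ℝ, ((1 + |x|) ^ (4 * k))⁻¹) * (∫ y : ℝ, ((1 + |y|) ^ (2 * (4 * k)))⁻¹)
      = (4 * CT ^ 2 * ∫ y : ℝ, ((1 + |y|) ^ 2)⁻¹) *
          (((q : ℝ) + 1)⁻¹ ^ (2 * (2 * k) + 2) * ((((q ^ 2 : ℕ) : ℝ)) * ((q : ℝ) + 1)⁻¹)) +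
        (4 * M ^ 2 * (∫ x : ℝ, ((1 + |x|) ^ (4 * k))⁻¹) * (∫ y : ℝ, ((1 + |y|) ^ (2 * (4 * k)))⁻¹)) *
          ((1 + (((q ^ 2 : ℕ) : ℝ)) * ((q : ℝ) + 1)⁻¹) ^ (4 * k))⁻¹ := by ring
    _ ≤ (4 * CT ^ 2 * ∫ y : ℝ, ((1 + |y|) ^ 2)⁻¹) * (((q : ℝ) + 1) ^ (4 * k))⁻¹ +
        (4 * M ^ 2 * (∫ x : ℝ, ((1 + |x|) ^ (4 * k))⁻¹) * (∫ y : ℝ, ((1 + |y|) ^ (2 * (4 * k)))⁻¹)) *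
          (2 ^ (4 * k) * (((q : ℝ) + 1) ^ (4 * k))⁻¹) := add_le_add t1 t2
    _ = _ := by ring


/-! ## Part E. The second quadrant by reflection, and the assembly over `Fin n` -/

/-- RH-FREE plumbing. Complex conjugation preserves `L²`. [folklore] -/
private theorem memLp_conj' {u : ℝ → ℂ} (hu : MemLp u 2 (volume : Measure ℝ)) :
    MemLp (fun x => conj (u x)) 2 (volume : Measure ℝ) :=
  hu.of_le (Complex.continuous_conj.comp_aestronglyMeasurable hu.1)
    (Eventually.of_forall fun x => by rw [Complex.norm_conj])

/-- `‖u − v‖² ≤ 2‖u‖² + 2‖v‖²`. [folklore] -/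
private theorem norm_sub_sq_le (u v : ℂ) : ‖u - v‖ ^ 2 ≤ 2 * ‖u‖ ^ 2 + 2 * ‖v‖ ^ 2 := by
  have h1 : ‖u - v‖ ≤ ‖u‖ + ‖v‖ := norm_sub_le u v
  have h2 : 0 ≤ ‖u - v‖ := norm_nonneg _
  have h3 : ‖u - v‖ ^ 2 ≤ (‖u‖ + ‖v‖) ^ 2 := pow_le_pow_left₀ h2 h1 2
  nlinarith [sq_nonneg (‖u‖ - ‖v‖)]

end FrequencyKernelApprox

open FrequencyKernelApprox in
/-- RH-FREE. **The direct kernel estimate of App. D Rem. 48, assembled: the frequency kernel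
`K(ξ,η) = −2 f̂(ξ−η)(1_{ξ>0≥η} − 1_{ξ≤0<η})` of `[H, f]` (`f` Schwartz) is, for every `k`, within
`C_k (n+1)^{−k}` in `L²(ℝ²)` of a separable kernel `Σ_{i<n} a_i(ξ) conj(c_i(η))`, `a_i, c_i ∈ L²(ℝ)`** —
verbatim the hypothesis `h` of `isInfiniteOrder_quantizedDiff_of_frequencyKernelApprox`, hence (with
`CC2021_lemma_D47_iff_isInfiniteOrder`) the last input of the discharge of App. D Lemma 47 "`[H, f]` is an
infinitesimal of infinite order".  Proof: the quadrant estimate `FrequencyKernelApprox.quadrant_separableApprox`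
for `f̂` on `{ξ>0≥η}` and for the reflected `f̂(−·)` with the variables swapped on `{ξ≤0<η}` (exponent `k+1`,
`q = ⌊√(n/(2(2k+3)))⌋`, so `2q²(2k+3) ≤ n` pieces and `n + 1 ≤ 2(2k+3)(q+1)²`), `‖E₁ − E₂‖² ≤ 2‖E₁‖² + 2‖E₂‖²`,
and zero-padding of the pieces to `Fin n`.
[cite: ConnesConsani2021, App. D Rem. 48 p. 33 (arXiv chunk p0033:L39–41) and Lemma 47 proof (L24–36); Connes1994, Chap. IV §2.α] -/
theorem frequencyKernel_separableApprox :
    ∀ f : SchwartzMap ℝ ℂ, ∀ k : ℕ, ∃ C : ℝ, ∀ n : ℕ,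
      ∃ a c : Fin n → Lp (α := ℝ) ℂ 2,
        Real.sqrt (∫ z : ℝ × ℝ, ‖(-2) * (𝓕 (f : ℝ → ℂ) (z.1 - z.2) *
          ((if 0 < z.1 ∧ z.2 ≤ 0 then (1 : ℂ) else 0) - (if z.1 ≤ 0 ∧ 0 < z.2 then (1 : ℂ) else 0))) -
          ∑ i, (a i : ℝ → ℂ) z.1 * (starRingEnd ℂ) ((c i : ℝ → ℂ) z.2)‖ ^ 2 ∂((volume : Measure ℝ).prod volume))
          * ((n : ℝ) + 1) ^ k ≤ C := by
  intro f k
  classical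
  -- the Fourier transform as a Schwartz function and the two quadrant estimates (exponent `k + 1`)
  set g : SchwartzMap ℝ ℂ := 𝓕 f with hgdef
  have hg : ∀ x, 𝓕 (f : ℝ → ℂ) x = g x := fun x => (congrFun (SchwartzMap.fourier_coe f) x).symm
  obtain ⟨C₁, hC₁, H₁⟩ := quadrant_separableApprox g (k := k + 1) (by omega)
  -- the reflected Schwartz function `ǧ(x) = g(−x)` (`SchwartzMap.compCLMOfContinuousLinearEquiv`)
  set gr : SchwartzMap ℝ ℂ := SchwartzMap.compCLMOfContinuousLinearEquiv ℂ (ContinuousLinearEquiv.neg ℝ) g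
    with hgrdef
  have hgr : ∀ x : ℝ, gr x = g (-x) := fun x => rfl
  obtain ⟨C₂, hC₂, H₂⟩ := quadrant_separableApprox gr (k := k + 1) (by omega)
  set a₀ : ℕ := 2 * (2 * (k + 1) + 1) with ha₀
  have ha₀pos : 0 < a₀ := by positivity
  refine ⟨2 * Real.sqrt (C₁ + C₂) * (a₀ : ℝ) ^ (k + 1), fun n => ?_⟩
  set q : ℕ := Nat.sqrt (n / a₀) with hq
  obtain ⟨A₁, B₁, hA₁, hB₁, F₁, hF₁i, hF₁, hI₁⟩ := H₁ q
  obtain ⟨A₂, B₂, hA₂, hB₂, F₂, hF₂i, hF₂, hI₂⟩ := H₂ q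
  -- the index type of the pieces of both quadrants; its cardinality is at most `n`
  set ι := (Fin (q ^ 2) × Fin (2 * (k + 1) + 1)) ⊕ (Fin (q ^ 2) × Fin (2 * (k + 1) + 1)) with hι
  have hcard : Fintype.card ι ≤ n := by
    simp only [hι, Fintype.card_sum, Fintype.card_prod, Fintype.card_fin]
    have h1 : q ^ 2 ≤ n / a₀ := by rw [hq]; exact Nat.sqrt_le' (n / a₀)
    have h2 : a₀ * (n / a₀) ≤ n := Nat.mul_div_le n a₀
    have h3 : q ^ 2 * (2 * (k + 1) + 1) + q ^ 2 * (2 * (k + 1) + 1) = a₀ * q ^ 2 := by rw [ha₀]; ring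
    rw [h3]
    exact le_trans (Nat.mul_le_mul_left _ h1) h2
  -- the explicit pieces: quadrant one as is, quadrant two reflected, swapped, conjugated, with a sign
  set Af : ι → ℝ → ℂ := Sum.elim (fun i => A₁ i) (fun i ξ => -conj (B₂ i ξ)) with hAfdef
  set Cf : ι → ℝ → ℂ := Sum.elim (fun i => B₁ i) (fun i η => conj (A₂ i η)) with hCfdef
  have hAf : ∀ j, MemLp (Af j) 2 (volume : Measure ℝ) := by
    rintro (i | i)
    · exact hA₁ i
    · exact (memLp_conj' (hB₂ i)).neg
  have hCf : ∀ j, MemLp (Cf j) 2 (volume : Measure ℝ) := by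
    rintro (i | i)
    · exact hB₁ i
    · exact memLp_conj' (hA₂ i)
  -- as `L²` vectors, padded with zeros to `Fin n`
  set aι : ι → Lp (α := ℝ) ℂ 2 := fun j => (hAf j).toLp (Af j) with haι
  set cι : ι → Lp (α := ℝ) ℂ 2 := fun j => (hCf j).toLp (Cf j) with hcι
  set e : ι ↪ Fin n := (Fintype.equivFin ι).toEmbedding.trans (Fin.castLEEmb hcard) with he
  set a' : Fin n → Lp (α := ℝ) ℂ 2 := Function.extend e aι 0 with ha'
  set c' : Fin n → Lp (α := ℝ) ℂ 2 := Function.extend e cι 0 with hc'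
  refine ⟨a', c', ?_⟩
  have ha'e : ∀ j, a' (e j) = aι j := fun j => by rw [ha', e.injective.extend_apply]
  have hc'e : ∀ j, c' (e j) = cι j := fun j => by rw [hc', e.injective.extend_apply]
  have ha'0 : ∀ i, (¬ ∃ j, e j = i) → a' i = 0 := fun i hi => by
    rw [ha', Function.extend_apply' _ _ _ hi, Pi.zero_apply]
  -- a.e. on the product the padded separable sum is the explicit one
  have hx : ∀ᵐ x ∂(volume : Measure ℝ), (∀ i : Fin n, (¬ ∃ j, e j = i) → (a' i : ℝ → ℂ) x = 0) ∧
      ∀ j : ι, (aι j : ℝ → ℂ) x = Af j x := by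
    refine (ae_all_iff.2 fun i => ?_).and (ae_all_iff.2 fun j => ?_)
    · by_cases hi : ∃ j, e j = i
      · exact Eventually.of_forall fun x h => (h hi).elim
      · rw [ha'0 i hi]
        filter_upwards [Lp.coeFn_zero ℂ 2 (volume : Measure ℝ)] with x hx0
        exact fun _ => by rw [hx0, Pi.zero_apply]
    · exact (hAf j).coeFn_toLp
  have hy : ∀ᵐ y ∂(volume : Measure ℝ), ∀ j : ι, (cι j : ℝ → ℂ) y = Cf j y :=
    ae_all_iff.2 fun j => (hCf j).coeFn_toLp
  have hz : ∀ᵐ z ∂((volume : Measure ℝ).prod volume),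
      ∑ i, (a' i : ℝ → ℂ) z.1 * (starRingEnd ℂ) ((c' i : ℝ → ℂ) z.2) =
        ∑ j, Af j z.1 * conj (Cf j z.2) := by
    filter_upwards [(Measure.quasiMeasurePreserving_fst (μ := (volume : Measure ℝ))
        (ν := (volume : Measure ℝ))).ae hx,
      (Measure.quasiMeasurePreserving_snd (μ := (volume : Measure ℝ))
        (ν := (volume : Measure ℝ))).ae hy] with z hz1 hz2
    rw [← Finset.sum_subset (Finset.subset_univ (Finset.univ.map e))
        (fun i _ hi => by
          have hi' : ¬ ∃ j, e j = i := fun ⟨j, hj⟩ => hi (Finset.mem_map.2 ⟨j, Finset.mem_univ _, hj⟩)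
          rw [hz1.1 i hi', zero_mul]),
      Finset.sum_map]
    refine Finset.sum_congr rfl fun j _ => ?_
    rw [ha'e, hc'e, hz1.2 j, hz2 j]
  -- pointwise, the total error is the difference of the two quadrant errors
  have hpt : ∀ z : ℝ × ℝ, ‖(-2) * (𝓕 (f : ℝ → ℂ) (z.1 - z.2) *
      ((if 0 < z.1 ∧ z.2 ≤ 0 then (1 : ℂ) else 0) - (if z.1 ≤ 0 ∧ 0 < z.2 then (1 : ℂ) else 0))) -
      ∑ j, Af j z.1 * conj (Cf j z.2)‖ ^ 2 ≤ 2 * F₁ z + 2 * F₂ z.swap := by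
    intro z
    have e1 := hF₁ z
    have e2 := hF₂ z.swap
    simp only [Prod.fst_swap, Prod.snd_swap, hgr, neg_sub] at e2
    have hsum : ∑ j, Af j z.1 * conj (Cf j z.2) =
        ∑ i, A₁ i z.1 * conj (B₁ i z.2) - ∑ i, A₂ i z.2 * conj (B₂ i z.1) := by
      rw [hAfdef, hCfdef, Fintype.sum_sum_type]
      simp only [Sum.elim_inl, Sum.elim_inr, Complex.conj_conj, neg_mul, Finset.sum_neg_distrib]
      rw [sub_eq_add_neg]
      congr 2
      exact Finset.sum_congr rfl fun i _ => mul_comm _ _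
    have hand : (if z.1 ≤ 0 ∧ 0 < z.2 then (1 : ℂ) else 0) =
        (if 0 < z.2 ∧ z.1 ≤ 0 then (1 : ℂ) else 0) := by
      simp only [and_comm]
    rw [hsum, hg, hand]
    have halg : (-2) * (g (z.1 - z.2) * ((if 0 < z.1 ∧ z.2 ≤ 0 then (1 : ℂ) else 0) -
        (if 0 < z.2 ∧ z.1 ≤ 0 then (1 : ℂ) else 0))) -
        (∑ i, A₁ i z.1 * conj (B₁ i z.2) - ∑ i, A₂ i z.2 * conj (B₂ i z.1)) =
        ((-2) * g (z.1 - z.2) * (if 0 < z.1 ∧ z.2 ≤ 0 then (1 : ℂ) else 0) -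
          ∑ i, A₁ i z.1 * conj (B₁ i z.2)) -
        ((-2) * g (z.1 - z.2) * (if 0 < z.2 ∧ z.1 ≤ 0 then (1 : ℂ) else 0) -
          ∑ i, A₂ i z.2 * conj (B₂ i z.1)) := by ring
    rw [halg]
    refine (norm_sub_sq_le _ _).trans ?_
    exact add_le_add (mul_le_mul_of_nonneg_left e1 (by norm_num))
      (mul_le_mul_of_nonneg_left e2 (by norm_num))
  -- integrate
  have hF₂s : Integrable (fun z : ℝ × ℝ => F₂ z.swap) ((volume : Measure ℝ).prod volume) := hF₂i.swap
  have hInt : Integrable (fun z : ℝ × ℝ => 2 * F₁ z + 2 * F₂ z.swap) ((volume : Measure ℝ).prod volume) :=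
    (hF₁i.const_mul 2).add (hF₂s.const_mul 2)
  set X : ℝ := (((q : ℝ) + 1) ^ (4 * (k + 1)))⁻¹ with hX
  have hq1 : (0 : ℝ) < (q : ℝ) + 1 := by positivity
  have hX0 : 0 ≤ X := by positivity
  have hbound : ∫ z : ℝ × ℝ, ‖(-2) * (𝓕 (f : ℝ → ℂ) (z.1 - z.2) *
      ((if 0 < z.1 ∧ z.2 ≤ 0 then (1 : ℂ) else 0) - (if z.1 ≤ 0 ∧ 0 < z.2 then (1 : ℂ) else 0))) -
      ∑ i, (a' i : ℝ → ℂ) z.1 * (starRingEnd ℂ) ((c' i : ℝ → ℂ) z.2)‖ ^ 2 ∂((volume : Measure ℝ).prod volume)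
      ≤ 4 * (C₁ + C₂) * X := by
    calc ∫ z : ℝ × ℝ, ‖(-2) * (𝓕 (f : ℝ → ℂ) (z.1 - z.2) *
          ((if 0 < z.1 ∧ z.2 ≤ 0 then (1 : ℂ) else 0) - (if z.1 ≤ 0 ∧ 0 < z.2 then (1 : ℂ) else 0))) -
          ∑ i, (a' i : ℝ → ℂ) z.1 * (starRingEnd ℂ) ((c' i : ℝ → ℂ) z.2)‖ ^ 2 ∂((volume : Measure ℝ).prod volume)
        = ∫ z : ℝ × ℝ, ‖(-2) * (𝓕 (f : ℝ → ℂ) (z.1 - z.2) *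
          ((if 0 < z.1 ∧ z.2 ≤ 0 then (1 : ℂ) else 0) - (if z.1 ≤ 0 ∧ 0 < z.2 then (1 : ℂ) else 0))) -
          ∑ j, Af j z.1 * conj (Cf j z.2)‖ ^ 2 ∂((volume : Measure ℝ).prod volume) :=
          integral_congr_ae (by filter_upwards [hz] with z hz'; rw [hz'])
      _ ≤ ∫ z : ℝ × ℝ, (2 * F₁ z + 2 * F₂ z.swap) ∂((volume : Measure ℝ).prod volume) :=
          integral_mono_of_nonneg (Eventually.of_forall fun z => by positivity) hInt
            (Eventually.of_forall hpt)
      _ = 2 * (∫ z, F₁ z ∂((volume : Measure ℝ).prod volume)) +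
          2 * ∫ z : ℝ × ℝ, F₂ z.swap ∂((volume : Measure ℝ).prod volume) := by
          rw [integral_add (hF₁i.const_mul 2) (hF₂s.const_mul 2), integral_const_mul,
            integral_const_mul]
      _ = 2 * (∫ z, F₁ z ∂((volume : Measure ℝ).prod volume)) +
          2 * ∫ z, F₂ z ∂((volume : Measure ℝ).prod volume) := by
          rw [integral_prod_swap]
      _ ≤ 2 * (C₁ * X) + 2 * (C₂ * X) := by gcongr
      _ ≤ 4 * (C₁ + C₂) * X := by nlinarith [mul_nonneg (add_nonneg hC₁ hC₂) hX0]
  -- `√(4 (C₁+C₂) X) = 2 √(C₁+C₂) (q+1)^{−2(k+1)}` and `(n+1)^k ≤ (2(2k+3)(q+1)²)^{k+1}`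
  have hS : Real.sqrt (∫ z : ℝ × ℝ, ‖(-2) * (𝓕 (f : ℝ → ℂ) (z.1 - z.2) *
      ((if 0 < z.1 ∧ z.2 ≤ 0 then (1 : ℂ) else 0) - (if z.1 ≤ 0 ∧ 0 < z.2 then (1 : ℂ) else 0))) -
      ∑ i, (a' i : ℝ → ℂ) z.1 * (starRingEnd ℂ) ((c' i : ℝ → ℂ) z.2)‖ ^ 2 ∂((volume : Measure ℝ).prod volume))
      ≤ 2 * Real.sqrt (C₁ + C₂) * (((q : ℝ) + 1) ^ (2 * (k + 1)))⁻¹ := by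
    rw [← Real.sqrt_sq (show 0 ≤ 2 * Real.sqrt (C₁ + C₂) * (((q : ℝ) + 1) ^ (2 * (k + 1)))⁻¹ by
      positivity)]
    refine Real.sqrt_le_sqrt (hbound.trans (le_of_eq ?_))
    have hsq : ((((q : ℝ) + 1) ^ (2 * (k + 1)))⁻¹) ^ 2 = (((q : ℝ) + 1) ^ (4 * (k + 1)))⁻¹ := by
      rw [inv_pow, ← pow_mul, show 2 * (k + 1) * 2 = 4 * (k + 1) by ring]
    rw [mul_pow, mul_pow, Real.sq_sqrt (by positivity), hsq, hX]
    ring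
  have hn1 : ((n : ℝ) + 1) ≤ (a₀ : ℝ) * ((q : ℝ) + 1) ^ 2 := by
    have h1 : n < a₀ * (n / a₀ + 1) := Nat.lt_mul_div_succ n ha₀pos
    have h2 : n / a₀ + 1 ≤ (q + 1) ^ 2 := by rw [hq]; exact Nat.lt_succ_sqrt' (n / a₀)
    have h3 : n + 1 ≤ a₀ * (q + 1) ^ 2 := by
      have := Nat.mul_le_mul_left a₀ h2
      omega
    exact_mod_cast h3
  have hpow : ((n : ℝ) + 1) ^ k ≤ ((a₀ : ℝ) * ((q : ℝ) + 1) ^ 2) ^ (k + 1) := by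
    calc ((n : ℝ) + 1) ^ k ≤ ((n : ℝ) + 1) ^ (k + 1) :=
          pow_le_pow_right₀ (by linarith [n.cast_nonneg (α := ℝ)]) (by omega)
      _ ≤ _ := pow_le_pow_left₀ (by positivity) hn1 _
  calc Real.sqrt (∫ z : ℝ × ℝ, ‖(-2) * (𝓕 (f : ℝ → ℂ) (z.1 - z.2) *
          ((if 0 < z.1 ∧ z.2 ≤ 0 then (1 : ℂ) else 0) - (if z.1 ≤ 0 ∧ 0 < z.2 then (1 : ℂ) else 0))) -
          ∑ i, (a' i : ℝ → ℂ) z.1 * (starRingEnd ℂ) ((c' i : ℝ → ℂ) z.2)‖ ^ 2 ∂((volume : Measure ℝ).prod volume))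
          * ((n : ℝ) + 1) ^ k
      ≤ (2 * Real.sqrt (C₁ + C₂) * (((q : ℝ) + 1) ^ (2 * (k + 1)))⁻¹) *
          ((a₀ : ℝ) * ((q : ℝ) + 1) ^ 2) ^ (k + 1) :=
        mul_le_mul hS hpow (by positivity) (by positivity)
    _ = 2 * Real.sqrt (C₁ + C₂) * (a₀ : ℝ) ^ (k + 1) := by
        rw [mul_pow, ← pow_mul, show 2 * (k + 1) = 2 * (k + 1) by rfl]
        field_simp

end Literature.NumberTheory.ConnesConsani2021
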